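import Literature.NumberTheory.LFunctions.SchoenfeldZeroSums
import Literature.NumberTheory.LFunctions.MertensCertificate.Chunk00
import Literature.NumberTheory.LFunctions.MertensCertificate.Chunk01
import Literature.NumberTheory.LFunctions.MertensCertificate.Chunk02
import Literature.NumberTheory.LFunctions.MertensCertificate.Chunk03
import Literature.NumberTheory.LFunctions.MertensCertificate.Chunk04
import Literature.NumberTheory.LFunctions.MertensCertificate.Chunk05
import Literature.NumberTheory.LFunctions.MertensCertificate.Chunk06
import Literature.NumberTheory.LFunctions.MertensCertificate.Chunk07
import Literature.NumberTheory.LFunctions.MertensCertificate.Chunk08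
import Literature.NumberTheory.LFunctions.MertensCertificate.Chunk09
import Literature.NumberTheory.LFunctions.MertensCertificate.Chunk10
import Literature.NumberTheory.LFunctions.MertensCertificate.Chunk11
import Literature.NumberTheory.LFunctions.MertensCertificate.Chunk12
import Literature.NumberTheory.LFunctions.MertensCertificate.Chunk13
import Literature.NumberTheory.LFunctions.MertensCertificate.Chunk14
import Literature.NumberTheory.LFunctions.MertensCertificate.Chunk15
import Literature.NumberTheory.LFunctions.MertensCertificate.Chunk16
import Literature.NumberTheory.LFunctions.MertensCertificate.Chunk17
import Literature.NumberTheory.LFunctions.MertensCertificate.Chunk18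
import Literature.NumberTheory.LFunctions.MertensCertificate.Chunk19
import Literature.NumberTheory.LFunctions.MertensCertificate.Top
import Literature.Analysis.SpecialFunctions.KernelLog
import HarnessLib

/-!
# The zeros of `ζ` below height `2516` and the two zero sums there (certified data)

Topic: `Literature/NumberTheory/LFunctions`. THEOREMS (everything proved; two `native_decide`
evaluations declared `computational`, and this file depends on the 21 compiled blocks of the
tree's certified Odlyzko–te Riele computation, `MertensCertificate/Chunk00–19.lean`, `Top.lean`).
Numerical half of the analytic input to the discharge of
`Literature.NumberTheory.LFunctions.schoenfeld_explicit` (Schoenfeld 1976, Thm. 10 / Cor. 1): Rosser–Schoenfeld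
and Schoenfeld take the zeros of `ζ` below a height `D` from tables (Rosser–Schoenfeld 1975 §4,
Lehman's zeros) and use `N(T)`-estimates only above it. Here `D = 2516` and the "table" is the
tree's certified computation (`MertensCertificate.lean`): `2000` brackets
`γ_j ∈ [a_j, a_j + 1]·2⁻²⁴⁰` each containing an ordinate of a zero on the critical line
(`checkChunk_sound`), and `N(2516) = 2000` (`zetaZeroCount_of_checkTop`). We derive:

* `lowOrdinate j` (`j < 2000`) — the ordinates; `zero_eq_of_im_le_heightT0` — **every zero of `ζ`
  with `0 ≤ Re ρ ≤ 1`, `0 < Im ρ ≤ 2516` is `½ + iγ_j` for some `j < 2000`**, and is simple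
  (`riemannZetaZeroOrder_lowOrdinate`); `zerosBetween_zero_heightT0` — the finite set
  `zerosBetween 0 2516` of `SchoenfeldZeroSums.lean` is `{½ + iγ_j : j < 2000}`.
* `sumInvNorm_heightT0_le` — **`sumInvNorm 2516 ≤ 5.681`** (`= 2∑_j 1/|½+iγ_j| ≤ 2∑_j 1/a_j 2²⁴⁰`,
  the integer sum `invOrdSum` evaluated by `native_decide`); numerically `2∑_j 1/|ρ_j| = 5.68081`.
* `le_sumInvNormSq_heightT0` — **`0.04530674 ≤ sumInvNormSq 2516`** (`= 2∑_j 1/(¼ + γ_j²)`).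
* `sumInvNorm_100_le`, `le_sumInvNormSq_100`, `tail_100_le` — the same at height `100` (the first `29`
  zeros): `sumInvNorm 100 ≤ 1.1845`, `0.0342005 ≤ sumInvNormSq 100`, `β − sumInvNormSq 100 ≤ 0.011991`
  (used for the auxiliary bound `ψ(y) ≤ 1.04 y`).
* `nicolasBeta_lt_d8` — `β < 0.04619147` (`β = 2 + γ − log π − 2 log 2 = 0.0461914179…`, from the
  tree's `γ` to `10⁻⁷`, `log π` by the kernel enclosure `KernelLog.logIv` and `π > 3.14159265358979323846`,
  Mathlib's `log 2`), whence `tail_heightT0_le` — under RH, `β − sumInvNormSq 2516 ≤ 0.00088473`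
  (the contribution `∑_{|Im ρ| > 2516} m(ρ)/|ρ|²`).

## References

* J. B. Rosser, L. Schoenfeld, Math. Comp. 29 (1975), 243–269, §4 (zeros below `D` from tables).
  [RosserSchoenfeld1975]
* L. Schoenfeld, Math. Comp. 30 (1976), 337–360, proof of Thm. 10. [Schoenfeld1976]
* A. M. Odlyzko, H. J. J. te Riele, J. reine angew. Math. 357 (1985), §4.2 (the first 2000 zeros).
  [OdlyzkoTeRiele1985]
-/

noncomputable section

open Complex Filter Set
open scoped Real

namespace Literature.NumberTheory.LFunctions

namespace SchoenfeldBound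

open NicolasJExplicit ZetaNumerics.Mertens MertensCertificate.ZetaNumerics.Mertens
  Literature.NumberTheory.LFunctions.MertensZeroCertificate

/-! ### The certified blocks -/

/-- All twenty blocks of the certificate pass. [cite: OdlyzkoTeRiele1985, §4.2 p. 151] -/
theorem checkChunk_all : ∀ k < NCHUNK, checkChunk k = true := by
  intro k hk
  have hk20 : k < 20 := hk
  interval_cases k
  · exact checkChunk_00
  · exact checkChunk_01
  · exact checkChunk_02
  · exact checkChunk_03
  · exact checkChunk_04
  · exact checkChunk_05
  · exact checkChunk_06
  · exact checkChunk_07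
  · exact checkChunk_08
  · exact checkChunk_09
  · exact checkChunk_10
  · exact checkChunk_11
  · exact checkChunk_12
  · exact checkChunk_13
  · exact checkChunk_14
  · exact checkChunk_15
  · exact checkChunk_16
  · exact checkChunk_17
  · exact checkChunk_18
  · exact checkChunk_19

/-- Per zero: the bracket is well ordered and contains an ordinate of a critical zero. [cite: OdlyzkoTeRiele1985, §4.2 p. 151] -/
theorem bracket_sound {j : ℕ} (hj : j < 2000) :
    orderOk j = true ∧ ∃ γ ∈ Set.Icc (t₁ j) (t₂ j), riemannZeta (1 / 2 + γ * I) = 0 := by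
  have hk : j / CHUNK < NCHUNK := by
    unfold CHUNK NCHUNK; omega
  have hi : j % CHUNK < CHUNK := Nat.mod_lt _ (by unfold CHUNK; norm_num)
  have := (checkChunk_sound (checkChunk_all _ hk)).1 (j % CHUNK) hi
  rwa [Nat.div_add_mod'] at this

/-- **The ordinates `γ_j`** (`j < 2000`; `0` otherwise): an ordinate of a zero of `ζ` on the critical
line inside the `j`-th certified bracket. [cite: OdlyzkoTeRiele1985, §4.2 p. 151] -/
def lowOrdinate (j : ℕ) : ℝ :=
  if h : j < 2000 then (bracket_sound h).2.choose else 0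

/-- `γ_j ∈ [t₁ⱼ, t₂ⱼ]` and `ζ(½ + iγ_j) = 0`. [cite: OdlyzkoTeRiele1985, §4.2 p. 151] -/
theorem lowOrdinate_spec {j : ℕ} (hj : j < 2000) :
    lowOrdinate j ∈ Set.Icc (t₁ j) (t₂ j) ∧ riemannZeta (1 / 2 + lowOrdinate j * I) = 0 := by
  have := (bracket_sound hj).2.choose_spec
  simp only [lowOrdinate, dif_pos hj]
  exact this

/-- The brackets: `2·2²⁴⁰ ≤ a_j`, `t₂ⱼ < 2516`, and `t₂ⱼ < t₁,ⱼ₊₁`. [cite: OdlyzkoTeRiele1985, §4.2 p. 151] -/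
theorem bracket_order {j : ℕ} (hj : j < 2000) :
    2 * 2 ^ 240 ≤ ordinate j ∧ t₂ j < heightT0 ∧ (j + 1 < 2000 → t₂ j < t₁ (j + 1)) := by
  obtain ⟨h1, h2, h3⟩ := orderOk_sound (bracket_sound hj).1
  have h2p : (0 : ℝ) < 2 ^ 240 := by positivity
  refine ⟨h1, ?_, fun hj1 ↦ ?_⟩
  · unfold t₂; rw [div_lt_iff₀ h2p]; exact_mod_cast h2
  · unfold t₁ t₂; rw [div_lt_div_iff_of_pos_right h2p]; exact_mod_cast h3 hj1

/-- `t₁ⱼ > 0` (indeed `≥ 2`). [folklore] -/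
theorem t₁_pos {j : ℕ} (hj : j < 2000) : 0 < t₁ j := by
  have h1 := (bracket_order hj).1
  unfold t₁
  have : (2 * 2 ^ 240 : ℝ) ≤ (ordinate j : ℝ) := by exact_mod_cast h1
  positivity

/-- The ordinates increase strictly: `γ_j < γ_{j'}` for `j < j' < 2000`. [folklore] -/
theorem lowOrdinate_strictMono {j j' : ℕ} (hjj' : j < j') (hj' : j' < 2000) :
    lowOrdinate j < lowOrdinate j' := by
  induction j' with
  | zero => exact absurd hjj' (Nat.not_lt_zero _)
  | succ j' ih =>
    have hsep := (bracket_order (by omega : j' < 2000)).2.2 hj'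
    have hle := (lowOrdinate_spec hj').1.1
    rcases Nat.lt_succ_iff_lt_or_eq.1 hjj' with hlt | heq
    · have := ih hlt (by omega)
      linarith [(lowOrdinate_spec (by omega : j' < 2000)).1.2]
    · subst heq
      linarith [(lowOrdinate_spec (by omega : j < 2000)).1.2]

/-- `γ_j ≠ γ_{j'}` for `j ≠ j'`. [folklore] -/
theorem lowOrdinate_injOn : Set.InjOn lowOrdinate (Finset.range 2000 : Set ℕ) := by
  intro j hj j' hj' h
  simp only [Finset.coe_range, Set.mem_Iio] at hj hj'
  by_contra hne
  rcases lt_or_gt_of_ne hne with hlt | hlt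
  · exact absurd h (lowOrdinate_strictMono hlt hj').ne
  · exact absurd h (lowOrdinate_strictMono hlt hj).ne'

/-- `0 < γ_j < 2516`. [folklore] -/
theorem lowOrdinate_pos_lt {j : ℕ} (hj : j < 2000) : 0 < lowOrdinate j ∧ lowOrdinate j < heightT0 := by
  obtain ⟨⟨h1, h2⟩, -⟩ := lowOrdinate_spec hj
  exact ⟨(t₁_pos hj).trans_le h1, h2.trans_lt (bracket_order hj).2.1⟩

/-! ### Every zero below `2516` is one of the `γ_j` -/

/-- The located ordinates as a finset, and the zero clause of the tree applied to them:
all zeros with `|Im ρ| < 2516` in the open strip are simple and on the line, and those with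
`0 < Im ρ < 2516` have ordinate `γ_j`. [cite: Brent1979, §4] -/
theorem zeros_below_heightT0 :
    (∀ ρ : ℂ, riemannZeta ρ = 0 → 0 < ρ.re → ρ.re < 1 → |ρ.im| < heightT0 →
        ρ.re = 1 / 2 ∧ deriv riemannZeta ρ ≠ 0) ∧
      (∀ ρ : ℂ, riemannZeta ρ = 0 → 0 < ρ.re → ρ.re < 1 → 0 < ρ.im → ρ.im < heightT0 →
        ρ.im ∈ (Finset.range 2000).image lowOrdinate) := by
  classical
  set Z : Finset ℝ := (Finset.range 2000).image lowOrdinate with hZdef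
  have hZcard : Z.card = 2000 := by
    rw [hZdef, Finset.card_image_of_injOn lowOrdinate_injOn, Finset.card_range]
  have hZ : ∀ γ' ∈ Z, riemannZeta (1 / 2 + γ' * I) = 0 ∧ 0 < γ' ∧ γ' < heightT0 := by
    intro γ' hγ'
    rw [hZdef, Finset.mem_image] at hγ'
    obtain ⟨j, hj, rfl⟩ := hγ'
    rw [Finset.mem_range] at hj
    exact ⟨(lowOrdinate_spec hj).2, lowOrdinate_pos_lt hj⟩
  have hN : zetaZeroCount heightT0 = Z.card := by
    rw [zetaZeroCount_of_checkTop checkTop_holds, hZcard]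
  exact zeros_below_of_count_eq_card Z hZ hN

/-- `N(2516) = 2000`. [cite: OdlyzkoTeRiele1985, §4.1 p. 150] -/
theorem zetaZeroCount_heightT0 : zetaZeroCount heightT0 = 2000 :=
  zetaZeroCount_of_checkTop checkTop_holds

/-- **Every zero `ρ` of `ζ` with `0 ≤ Re ρ ≤ 1` and `0 < Im ρ ≤ 2516` is `½ + iγ_j`, `j < 2000`.**
For `Im ρ < 2516` this is the zero clause; a zero at height exactly `2516` would be a `2001`-st
term in `N(2516) = ∑ m(ρ) = 2000`. [cite: Brent1979, §4] -/
theorem zero_eq_of_im_le_heightT0 {ρ : ℂ} (hz : riemannZeta ρ = 0) (h0 : 0 ≤ ρ.re) (h1 : ρ.re ≤ 1)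
    (him : 0 < ρ.im) (hT : ρ.im ≤ heightT0) :
    ∃ j < 2000, ρ = 1 / 2 + lowOrdinate j * I := by
  classical
  have hmem : ρ ∈ RHWave0.riemannZetaNontrivialZeros :=
    ZetaZeros.riemannZetaNontrivialZeros.mem_of_im_ne_zero hz him.ne'
  have hre0 := re_pos hmem
  have hre1 := re_lt_one hmem
  obtain ⟨hclause, hall⟩ := zeros_below_heightT0
  rcases hT.lt_or_eq with hlt | heq
  · have himZ := hall ρ hz hre0 hre1 him hlt
    rw [Finset.mem_image] at himZ
    obtain ⟨j, hj, hjρ⟩ := himZ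
    rw [Finset.mem_range] at hj
    have hre : ρ.re = 1 / 2 := (hclause ρ hz hre0 hre1 (by rw [abs_of_pos him]; exact hlt)).1
    refine ⟨j, hj, Complex.ext ?_ ?_⟩ <;> simp [hre, hjρ]
  · -- a zero at height exactly `2516` contradicts the count
    exfalso
    set e : ℕ → ℂ := fun j ↦ 1 / 2 + lowOrdinate j * I with he
    set B := (zetaZeroBox_finite 0 (heightT0 : ℝ)).toFinset with hB
    have hρB : ρ ∈ B := by
      rw [hB, Set.Finite.mem_toFinset]; exact ⟨hz, h0, h1, him, hT⟩
    have himg : (Finset.range 2000).image e ⊆ B := by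
      intro z hz'
      rw [Finset.mem_image] at hz'
      obtain ⟨j, hj, rfl⟩ := hz'
      rw [Finset.mem_range] at hj
      rw [hB, Set.Finite.mem_toFinset]
      obtain ⟨hp, hl⟩ := lowOrdinate_pos_lt hj
      refine ⟨(lowOrdinate_spec hj).2, by simp [he], by norm_num [he], by simpa [he] using hp,
        by simpa [he] using hl.le⟩
    have hρnot : ρ ∉ (Finset.range 2000).image e := by
      rw [Finset.mem_image]
      rintro ⟨j, hj, hjρ⟩
      rw [Finset.mem_range] at hj
      have : ρ.im = lowOrdinate j := by rw [← hjρ]; simp [he]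
      linarith [(lowOrdinate_pos_lt hj).2]
    have heinj : Set.InjOn e (Finset.range 2000 : Set ℕ) := by
      intro j hj j' hj' h
      have : lowOrdinate j = lowOrdinate j' := by
        have := congrArg Complex.im h; simpa [he] using this
      exact lowOrdinate_injOn hj hj' this
    have hcount := zetaZeroCount_eq_sum (heightT0 : ℝ)
    rw [zetaZeroCount_heightT0] at hcount
    have hsub : insert ρ ((Finset.range 2000).image e) ⊆ B := Finset.insert_subset hρB himg
    have hle : ∑ z ∈ insert ρ ((Finset.range 2000).image e), (riemannZetaZeroOrder z : ℝ) ≤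
        ∑ z ∈ B, (riemannZetaZeroOrder z : ℝ) :=
      Finset.sum_le_sum_of_subset_of_nonneg hsub fun z hz _ ↦ by
        rw [hB, Set.Finite.mem_toFinset] at hz
        exact_mod_cast riemannZetaZeroOrder_nonneg_of_mem_zetaZeroBox hz
    rw [Finset.sum_insert hρnot, Finset.sum_image heinj] at hle
    have h1ρ : (1 : ℝ) ≤ riemannZetaZeroOrder ρ := by
      exact_mod_cast ZetaZeros.riemannZetaNontrivialZeros.one_le_order hmem
    have h1j : ∀ j ∈ Finset.range 2000, (1 : ℝ) ≤ riemannZetaZeroOrder (e j) := by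
      intro j hj
      rw [Finset.mem_range] at hj
      have hm : e j ∈ RHWave0.riemannZetaNontrivialZeros :=
        ZetaZeros.riemannZetaNontrivialZeros.mem_of_im_ne_zero (lowOrdinate_spec hj).2
          (by simpa [he] using (lowOrdinate_pos_lt hj).1.ne')
      exact_mod_cast ZetaZeros.riemannZetaNontrivialZeros.one_le_order hm
    have h2000 : (2000 : ℝ) ≤ ∑ j ∈ Finset.range 2000, (riemannZetaZeroOrder (e j) : ℝ) := by
      have := Finset.sum_le_sum h1j
      simpa using this
    have hcount' : ∑ z ∈ B, (riemannZetaZeroOrder z : ℝ) = 2000 := by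
      rw [hB, ← hcount]; norm_num
    linarith

/-- The zeros `½ + iγ_j` are simple: `m = 1`. [cite: Brent1979, §4] -/
theorem riemannZetaZeroOrder_lowOrdinate {j : ℕ} (hj : j < 2000) :
    riemannZetaZeroOrder (1 / 2 + lowOrdinate j * I) = 1 := by
  obtain ⟨hclause, -⟩ := zeros_below_heightT0
  obtain ⟨hp, hl⟩ := lowOrdinate_pos_lt hj
  have hz := (lowOrdinate_spec hj).2
  have hd := (hclause _ hz (by norm_num) (by norm_num) (by simpa [abs_of_pos hp] using hl)).2
  have hne1 : (1 / 2 + lowOrdinate j * I : ℂ) ≠ 1 := by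
    intro h; have := congrArg Complex.im h; simp at this; linarith
  have ha : AnalyticAt ℂ riemannZeta (1 / 2 + lowOrdinate j * I) := analyticOn_riemannZeta _ hne1
  have hord : analyticOrderAt riemannZeta (1 / 2 + lowOrdinate j * I) = 1 :=
    ha.analyticOrderAt_eq_one_of_zero_deriv_ne_zero hz hd
  rw [riemannZetaZeroOrder, ha.meromorphicOrderAt_eq, hord]
  rfl

/-- **`zerosBetween 0 2516 = {½ + iγ_j : j < 2000}`.** [cite: Brent1979, §4] -/
theorem zerosBetween_zero_heightT0 :
    zerosBetween 0 heightT0 = (Finset.range 2000).image fun j ↦ (1 / 2 + lowOrdinate j * I : ℂ) := by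
  classical
  ext ρ
  rw [mem_zerosBetween le_rfl, Finset.mem_image]
  constructor
  · rintro ⟨hz, h0, h1, him, hT⟩
    obtain ⟨j, hj, rfl⟩ := zero_eq_of_im_le_heightT0 hz h0 h1 him hT
    exact ⟨j, Finset.mem_range.2 hj, rfl⟩
  · rintro ⟨j, hj, rfl⟩
    rw [Finset.mem_range] at hj
    obtain ⟨hp, hl⟩ := lowOrdinate_pos_lt hj
    exact ⟨(lowOrdinate_spec hj).2, by simp, by norm_num, by simpa using hp, by simpa using hl.le⟩

/-! ### The two zero sums at height `2516`: integer arithmetic -/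

/-- `⌊2³⁰⁰/a_j⌋ + 1 ≥ 2⁶⁰ · 2²⁴⁰/a_j = 2⁶⁰/t₁ⱼ`. [folklore] -/
def invOrdTerm (j : ℕ) : ℕ := 2 ^ 300 / (ordinate j).toNat + 1

/-- `invOrdSum n = ∑_{j < n} invOrdTerm j`. [folklore] -/
def invOrdSum : ℕ → ℕ
  | 0 => 0
  | n + 1 => invOrdSum n + invOrdTerm n

/-- `⌊2⁵⁴⁰/(2⁴⁷⁸ + (a_j+1)²)⌋ ≤ 2⁶⁰/(¼ + t₂ⱼ²)`. [folklore] -/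
def invSqTerm (j : ℕ) : ℕ := 2 ^ 540 / (2 ^ 478 + ((ordinate j).toNat + 1) ^ 2)

/-- `invSqSum n = ∑_{j < n} invSqTerm j`. [folklore] -/
def invSqSum : ℕ → ℕ
  | 0 => 0
  | n + 1 => invSqSum n + invSqTerm n

/-- `invOrdSum n = ∑_{j<n} invOrdTerm j`. [folklore] -/
theorem invOrdSum_eq (n : ℕ) : invOrdSum n = ∑ j ∈ Finset.range n, invOrdTerm j := by
  induction n with
  | zero => rfl
  | succ n ih => rw [invOrdSum, ih, Finset.sum_range_succ]

/-- `invSqSum n = ∑_{j<n} invSqTerm j`. [folklore] -/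
theorem invSqSum_eq (n : ℕ) : invSqSum n = ∑ j ∈ Finset.range n, invSqTerm j := by
  induction n with
  | zero => rfl
  | succ n ih => rw [invSqSum, ih, Finset.sum_range_succ]

/-- **The compiled evaluation**: `2·invOrdSum 2000/2⁶⁰ ≤ 5.681` and `0.04530674 ≤ 2·invSqSum 2000/2⁶⁰`
(`invOrdSum 2000 = 3274867044734614616`, `invSqSum 2000 = 26117558415922292`). Declared to the gate as
`computational` (`native_decide`). [cite: OdlyzkoTeRiele1985, §4.2 p. 151] -/
theorem lowSums_check :
    invOrdSum 2000 * 2000 ≤ 5681 * 2 ^ 60 ∧ 4530674 * 2 ^ 60 ≤ invSqSum 2000 * (2 * 10 ^ 8) := by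
  native_decide

/-- **The compiled evaluation at height `100`**: the 29-th and 30-th brackets straddle `100`
(`t₂,₂₈ < 100 < t₁,₂₉`), `2·invOrdSum 29/2⁶⁰ ≤ 1.1845`, `0.0342005 ≤ 2·invSqSum 29/2⁶⁰`. Declared to the
gate as `computational` (`native_decide`). [cite: OdlyzkoTeRiele1985, §4.2 p. 151] -/
theorem lowSums100_check :
    ordinate 28 + 1 < 100 * 2 ^ 240 ∧ 100 * 2 ^ 240 < ordinate 29 ∧
      invOrdSum 29 * 20000 ≤ 11845 * 2 ^ 60 ∧ 342005 * 2 ^ 60 ≤ invSqSum 29 * (2 * 10 ^ 7) := by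
  native_decide

/-- Floor division in `ℝ`: `N/a < ⌊N/a⌋ + 1`. [folklore] -/
theorem cast_div_lt_floor_add_one (N : ℕ) {a : ℕ} (ha : 0 < a) :
    (N : ℝ) / a < ((N / a : ℕ) : ℝ) + 1 := by
  have h := Nat.div_add_mod N a
  have hr := Nat.mod_lt N ha
  have ha' : (0 : ℝ) < a := by exact_mod_cast ha
  rw [div_lt_iff₀ ha']
  have e : (N : ℝ) = (a : ℝ) * ((N / a : ℕ) : ℝ) + ((N % a : ℕ) : ℝ) := by exact_mod_cast h.symm
  have hr' : ((N % a : ℕ) : ℝ) < a := by exact_mod_cast hr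
  rw [e]
  nlinarith

/-- `1/t₁ⱼ ≤ invOrdTerm j / 2⁶⁰`. [folklore] -/
theorem inv_t₁_le {j : ℕ} (hj : j < 2000) : (t₁ j)⁻¹ ≤ (invOrdTerm j : ℝ) / 2 ^ 60 := by
  have h1 := (bracket_order hj).1
  have hnn : (0 : ℤ) ≤ ordinate j := le_trans (by positivity) h1
  have haz : ordinate j = ((ordinate j).toNat : ℤ) := (Int.toNat_of_nonneg hnn).symm
  have ha' : (ordinate j : ℝ) = ((ordinate j).toNat : ℝ) := by exact_mod_cast haz
  have ha0 : 0 < (ordinate j).toNat := by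
    have : (0 : ℤ) < ((ordinate j).toNat : ℤ) := by
      rw [← haz]; exact lt_of_lt_of_le (by positivity) h1
    exact_mod_cast this
  unfold t₁ invOrdTerm
  rw [ha', inv_div, Nat.cast_add, Nat.cast_one]
  -- make `a = a_j` and `P = 2²⁴⁰` opaque (no evaluation of the data or of large powers)
  generalize (ordinate j).toNat = a at ha0 ⊢
  clear ha' haz hnn h1
  generalize hP : (2 : ℝ) ^ 240 = P
  have ha0' : (0 : ℝ) < a := by exact_mod_cast ha0
  have hP0 : 0 < P := by rw [← hP]; exact pow_pos two_pos 240
  have h300 : ((2 ^ 300 : ℕ) : ℝ) = P * 2 ^ 60 := by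
    rw [Nat.cast_pow, Nat.cast_ofNat, show (300 : ℕ) = 240 + 60 from rfl, pow_add, hP]
  have hA := cast_div_lt_floor_add_one (2 ^ 300) ha0
  rw [h300] at hA
  -- remove every large power from the context before the final arithmetic
  generalize 2 ^ 300 / a = q at hA ⊢
  clear h300 hP
  have e : P / a = P * 2 ^ 60 / a / 2 ^ 60 := by field_simp
  rw [e]
  exact div_le_div_of_nonneg_right hA.le (by positivity)

/-- `(2²⁴⁰)² = 2⁴⁷⁸ · 4` in `ℝ` (powers kept unevaluated). [folklore] -/
theorem two_pow_240_sq : ((2 : ℝ) ^ 240) ^ 2 = ((2 ^ 478 : ℕ) : ℝ) * 4 := by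
  rw [Nat.cast_pow, Nat.cast_ofNat, ← pow_mul, show (240 * 2 : ℕ) = 478 + 2 from rfl, pow_add]
  congr 1
  norm_num

/-- `2⁵⁴⁰ = (2²⁴⁰)² · 2⁶⁰` in `ℝ` (powers kept unevaluated). [folklore] -/
theorem cast_two_pow_540 : ((2 ^ 540 : ℕ) : ℝ) = ((2 : ℝ) ^ 240) ^ 2 * 2 ^ 60 := by
  rw [Nat.cast_pow, Nat.cast_ofNat, ← pow_mul, show (540 : ℕ) = 240 * 2 + 60 from rfl, pow_add]

/-- `invSqTerm j / 2⁶⁰ ≤ 1/(¼ + t₂ⱼ²)`. [folklore] -/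
theorem invSqTerm_le {j : ℕ} (hj : j < 2000) : (invSqTerm j : ℝ) / 2 ^ 60 ≤ (1 / 4 + t₂ j ^ 2)⁻¹ := by
  have h1 := (bracket_order hj).1
  have hnn : (0 : ℤ) ≤ ordinate j := le_trans (by positivity) h1
  have haz : ordinate j = ((ordinate j).toNat : ℤ) := (Int.toNat_of_nonneg hnn).symm
  have ha' : (ordinate j : ℝ) = ((ordinate j).toNat : ℝ) := by exact_mod_cast haz
  have h478 := two_pow_240_sq
  have h540 := cast_two_pow_540
  unfold t₂ invSqTerm
  rw [ha']
  -- make `a = a_j`, `P = 2²⁴⁰` and `D = 2⁴⁷⁸ + (a+1)²` opaque; forget the data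
  generalize (ordinate j).toNat = a
  clear ha' haz hnn h1
  generalize hP : (2 : ℝ) ^ 240 = P at h478 h540 ⊢
  have hP0 : 0 < P := by rw [← hP]; exact pow_pos two_pos 240
  generalize hD : 2 ^ 478 + (a + 1) ^ 2 = D
  have hD' : (D : ℝ) = P ^ 2 / 4 + ((a : ℝ) + 1) ^ 2 := by
    rw [← hD, Nat.cast_add, Nat.cast_pow (a + 1), Nat.cast_add, Nat.cast_one]
    linarith [h478]
  have hdiv : ((2 ^ 540 / D : ℕ) : ℝ) ≤ P ^ 2 * 2 ^ 60 / D := by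
    rw [← h540]; exact Nat.cast_div_le
  -- remove every large power from the context before the final arithmetic
  generalize 2 ^ 540 / D = q at hdiv ⊢
  clear h478 h540 hD hP
  have hDpos : (0 : ℝ) < D := by rw [hD']; positivity
  have e : (1 / 4 + (((a : ℝ) + 1) / P) ^ 2)⁻¹ = P ^ 2 / D := by
    rw [hD', inv_eq_one_div, div_eq_div_iff (by positivity) (by positivity)]
    field_simp
  rw [e]
  calc (q : ℝ) / 2 ^ 60 ≤ P ^ 2 * 2 ^ 60 / D / 2 ^ 60 :=
        div_le_div_of_nonneg_right hdiv (by positivity)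
    _ = P ^ 2 / D := by field_simp

/-! ### The two zero sums at height `2516` -/

/-- `zerosUpTo 0 = ∅` (no zero is real), so `sumInvNorm 0 = sumInvNormSq 0 = 0`. [folklore] -/
theorem sumInvNorm_zero : sumInvNorm 0 = 0 ∧ sumInvNormSq 0 = 0 := by
  have h : zerosUpTo 0 = ∅ := by
    ext ρ
    simp only [mem_zerosUpTo, Finset.notMem_empty, iff_false, not_le]
    exact abs_pos.2 (ZetaZeros.riemannZetaNontrivialZeros.im_ne_zero ρ.2)
  simp [sumInvNorm, sumInvNormSq, h]

/-- **`sumInvNorm 2516 ≤ 5.681`**: `∑_{|Im ρ| ≤ 2516} m(ρ)/|ρ| = 2∑_{j<2000} 1/|½+iγ_j| ≤ 2∑_j 1/t₁ⱼ`.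
[cite: Schoenfeld1976, proof of Thm. 10 (zeros below D from tables)] -/
theorem sumInvNorm_heightT0_le : sumInvNorm heightT0 ≤ 5.681 := by
  classical
  have h := sumInvNorm_sub_le (T₁ := 0) (T₂ := heightT0) le_rfl (by unfold heightT0; norm_num)
  rw [sumInvNorm_zero.1, sub_zero, zerosBetween_zero_heightT0] at h
  have heinj : Set.InjOn (fun j ↦ (1 / 2 + lowOrdinate j * I : ℂ)) (Finset.range 2000 : Set ℕ) := by
    intro j hj j' hj' h
    exact lowOrdinate_injOn hj hj' (by have := congrArg Complex.im h; simpa using this)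
  rw [Finset.sum_image heinj] at h
  have hterm : ∀ j ∈ Finset.range 2000,
      (riemannZetaZeroOrder (1 / 2 + lowOrdinate j * I) : ℝ) * ((1 / 2 + lowOrdinate j * I : ℂ).im)⁻¹ ≤
        (invOrdTerm j : ℝ) / 2 ^ 60 := by
    intro j hj
    rw [Finset.mem_range] at hj
    rw [riemannZetaZeroOrder_lowOrdinate hj]
    have him : (1 / 2 + lowOrdinate j * I : ℂ).im = lowOrdinate j := by simp
    rw [him, Int.cast_one, one_mul]
    have ht := (lowOrdinate_spec hj).1.1
    exact (inv_anti₀ (t₁_pos hj) ht).trans (inv_t₁_le hj)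
  have hsum := Finset.sum_le_sum hterm
  rw [← Finset.sum_div] at hsum
  have hnat : ∑ j ∈ Finset.range 2000, (invOrdTerm j : ℝ) = (invOrdSum 2000 : ℝ) := by
    rw [invOrdSum_eq]; push_cast; rfl
  rw [hnat] at hsum
  have hchk : (invOrdSum 2000 : ℝ) * 2000 ≤ 5681 * 2 ^ 60 := by exact_mod_cast lowSums_check.1
  have : (invOrdSum 2000 : ℝ) / 2 ^ 60 ≤ 5.681 / 2 := by
    rw [div_le_iff₀ (by positivity)]; linarith
  linarith

/-- **`0.04530674 ≤ sumInvNormSq 2516`**: `∑_{|Im ρ| ≤ 2516} m(ρ)/|ρ|² = 2∑_{j<2000} 1/(¼ + γ_j²) ≥ 2∑_j 1/(¼ + t₂ⱼ²)`.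
[cite: Schoenfeld1976, proof of Thm. 10 (zeros below D from tables)] -/
theorem le_sumInvNormSq_heightT0 : 0.04530674 ≤ sumInvNormSq heightT0 := by
  classical
  have hhalf : ∀ ρ ∈ zerosBetween 0 (heightT0 : ℝ), ρ.re = 1 / 2 := by
    intro ρ hρ
    rw [zerosBetween_zero_heightT0, Finset.mem_image] at hρ
    obtain ⟨j, -, rfl⟩ := hρ
    simp
  have h := le_sumInvNormSq_sub_of_re (T₁ := 0) (T₂ := heightT0) le_rfl (by unfold heightT0; norm_num) hhalf
  rw [sumInvNorm_zero.2, sub_zero, zerosBetween_zero_heightT0] at h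
  have heinj : Set.InjOn (fun j ↦ (1 / 2 + lowOrdinate j * I : ℂ)) (Finset.range 2000 : Set ℕ) := by
    intro j hj j' hj' h
    exact lowOrdinate_injOn hj hj' (by have := congrArg Complex.im h; simpa using this)
  rw [Finset.sum_image heinj] at h
  have hterm : ∀ j ∈ Finset.range 2000, (invSqTerm j : ℝ) / 2 ^ 60 ≤
      (riemannZetaZeroOrder (1 / 2 + lowOrdinate j * I) : ℝ) *
        (1 / 4 + ((1 / 2 + lowOrdinate j * I : ℂ).im) ^ 2)⁻¹ := by
    intro j hj
    rw [Finset.mem_range] at hj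
    rw [riemannZetaZeroOrder_lowOrdinate hj]
    have him : (1 / 2 + lowOrdinate j * I : ℂ).im = lowOrdinate j := by simp
    rw [him, Int.cast_one, one_mul]
    have ht := (lowOrdinate_spec hj).1.2
    have hp := (lowOrdinate_pos_lt hj).1
    refine (invSqTerm_le hj).trans (inv_anti₀ (by positivity) ?_)
    nlinarith
  have hsum := Finset.sum_le_sum hterm
  rw [← Finset.sum_div] at hsum
  have hnat : ∑ j ∈ Finset.range 2000, (invSqTerm j : ℝ) = (invSqSum 2000 : ℝ) := by
    rw [invSqSum_eq]; push_cast; rfl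
  rw [hnat] at hsum
  have hchk : (4530674 : ℝ) * 2 ^ 60 ≤ (invSqSum 2000 : ℝ) * (2 * 10 ^ 8) := by
    exact_mod_cast lowSums_check.2
  have : (0.04530674 : ℝ) / 2 ≤ (invSqSum 2000 : ℝ) / 2 ^ 60 := by
    rw [le_div_iff₀ (by positivity)]; linarith
  linarith

/-! ### The same at height `100` (the first `29` zeros) -/

/-- `γ₂₈ < 100 < γ₂₉` (0-indexed): `t₂,₂₈ < 100 < t₁,₂₉`. [cite: OdlyzkoTeRiele1985, §4.2 p. 151] -/
theorem lowOrdinate_28_lt_100 : lowOrdinate 28 < 100 ∧ 100 < lowOrdinate 29 := by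
  obtain ⟨h1, h2, -, -⟩ := lowSums100_check
  have h2p : (0 : ℝ) < 2 ^ 240 := by positivity
  have ha : t₂ 28 < 100 := by
    unfold t₂; rw [div_lt_iff₀ h2p]; exact_mod_cast h1
  have hb : 100 < t₁ 29 := by
    unfold t₁; rw [lt_div_iff₀ h2p]; exact_mod_cast h2
  exact ⟨(lowOrdinate_spec (by norm_num)).1.2.trans_lt ha, hb.trans_le (lowOrdinate_spec (by norm_num)).1.1⟩

/-- **`zerosBetween 0 100 = {½ + iγ_j : j < 29}`.** [cite: Brent1979, §4] -/
theorem zerosBetween_zero_100 :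
    zerosBetween 0 100 = (Finset.range 29).image fun j ↦ (1 / 2 + lowOrdinate j * I : ℂ) := by
  classical
  obtain ⟨h28, h29⟩ := lowOrdinate_28_lt_100
  ext ρ
  rw [mem_zerosBetween le_rfl, Finset.mem_image]
  constructor
  · rintro ⟨hz, h0, h1, him, hT⟩
    obtain ⟨j, hj, rfl⟩ := zero_eq_of_im_le_heightT0 hz h0 h1 him
      (hT.trans (by unfold heightT0; norm_num))
    refine ⟨j, Finset.mem_range.2 ?_, rfl⟩
    by_contra hj29
    have hle : lowOrdinate 29 ≤ lowOrdinate j := by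
      rcases (not_lt.1 hj29).eq_or_lt with h | h
      · rw [h]
      · exact (lowOrdinate_strictMono h hj).le
    have : (1 / 2 + lowOrdinate j * I : ℂ).im = lowOrdinate j := by simp
    rw [this] at hT
    linarith
  · rintro ⟨j, hj, rfl⟩
    rw [Finset.mem_range] at hj
    have hj' : j < 2000 := by omega
    obtain ⟨hp, -⟩ := lowOrdinate_pos_lt hj'
    have hle : lowOrdinate j ≤ 100 := by
      rcases (Nat.lt_succ_iff.1 hj).eq_or_lt with h | h
      · rw [h]; exact h28.le
      · exact ((lowOrdinate_strictMono h (by norm_num)).trans h28).le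
    exact ⟨(lowOrdinate_spec hj').2, by simp, by norm_num, by simpa using hp, by simpa using hle⟩

/-- **`sumInvNorm 100 ≤ 1.1845`** (`= 2∑_{j<29} 1/|½+iγ_j|`; numerically `1.18445`).
[cite: Schoenfeld1976, proof of Thm. 10 (zeros below D from tables)] -/
theorem sumInvNorm_100_le : sumInvNorm 100 ≤ 1.1845 := by
  classical
  have h := sumInvNorm_sub_le (T₁ := 0) (T₂ := 100) le_rfl (by norm_num)
  rw [sumInvNorm_zero.1, sub_zero, zerosBetween_zero_100] at h
  have heinj : Set.InjOn (fun j ↦ (1 / 2 + lowOrdinate j * I : ℂ)) (Finset.range 29 : Set ℕ) := by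
    intro j hj j' hj' h
    have hj2 : j ∈ (Finset.range 2000 : Set ℕ) := by
      simp only [Finset.coe_range, Set.mem_Iio] at hj ⊢; omega
    have hj2' : j' ∈ (Finset.range 2000 : Set ℕ) := by
      simp only [Finset.coe_range, Set.mem_Iio] at hj' ⊢; omega
    exact lowOrdinate_injOn hj2 hj2' (by have := congrArg Complex.im h; simpa using this)
  rw [Finset.sum_image heinj] at h
  have hterm : ∀ j ∈ Finset.range 29,
      (riemannZetaZeroOrder (1 / 2 + lowOrdinate j * I) : ℝ) * ((1 / 2 + lowOrdinate j * I : ℂ).im)⁻¹ ≤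
        (invOrdTerm j : ℝ) / 2 ^ 60 := by
    intro j hj
    rw [Finset.mem_range] at hj
    have hj' : j < 2000 := by omega
    rw [riemannZetaZeroOrder_lowOrdinate hj']
    have him : (1 / 2 + lowOrdinate j * I : ℂ).im = lowOrdinate j := by simp
    rw [him, Int.cast_one, one_mul]
    have ht := (lowOrdinate_spec hj').1.1
    exact (inv_anti₀ (t₁_pos hj') ht).trans (inv_t₁_le hj')
  have hsum := Finset.sum_le_sum hterm
  rw [← Finset.sum_div] at hsum
  have hnat : ∑ j ∈ Finset.range 29, (invOrdTerm j : ℝ) = (invOrdSum 29 : ℝ) := by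
    rw [invOrdSum_eq]; push_cast; rfl
  rw [hnat] at hsum
  have hchk : (invOrdSum 29 : ℝ) * 20000 ≤ 11845 * 2 ^ 60 := by exact_mod_cast lowSums100_check.2.2.1
  have : (invOrdSum 29 : ℝ) / 2 ^ 60 ≤ 1.1845 / 2 := by
    rw [div_le_iff₀ (by positivity)]; linarith
  linarith

/-- **`0.0342005 ≤ sumInvNormSq 100`** (`= 2∑_{j<29} 1/(¼ + γ_j²)`; numerically `0.03420054`).
[cite: Schoenfeld1976, proof of Thm. 10 (zeros below D from tables)] -/
theorem le_sumInvNormSq_100 : 0.0342005 ≤ sumInvNormSq 100 := by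
  classical
  have hhalf : ∀ ρ ∈ zerosBetween 0 (100 : ℝ), ρ.re = 1 / 2 := by
    intro ρ hρ
    rw [zerosBetween_zero_100, Finset.mem_image] at hρ
    obtain ⟨j, -, rfl⟩ := hρ
    simp
  have h := le_sumInvNormSq_sub_of_re (T₁ := 0) (T₂ := 100) le_rfl (by norm_num) hhalf
  rw [sumInvNorm_zero.2, sub_zero, zerosBetween_zero_100] at h
  have heinj : Set.InjOn (fun j ↦ (1 / 2 + lowOrdinate j * I : ℂ)) (Finset.range 29 : Set ℕ) := by
    intro j hj j' hj' h
    have hj2 : j ∈ (Finset.range 2000 : Set ℕ) := by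
      simp only [Finset.coe_range, Set.mem_Iio] at hj ⊢; omega
    have hj2' : j' ∈ (Finset.range 2000 : Set ℕ) := by
      simp only [Finset.coe_range, Set.mem_Iio] at hj' ⊢; omega
    exact lowOrdinate_injOn hj2 hj2' (by have := congrArg Complex.im h; simpa using this)
  rw [Finset.sum_image heinj] at h
  have hterm : ∀ j ∈ Finset.range 29, (invSqTerm j : ℝ) / 2 ^ 60 ≤
      (riemannZetaZeroOrder (1 / 2 + lowOrdinate j * I) : ℝ) *
        (1 / 4 + ((1 / 2 + lowOrdinate j * I : ℂ).im) ^ 2)⁻¹ := by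
    intro j hj
    rw [Finset.mem_range] at hj
    have hj' : j < 2000 := by omega
    rw [riemannZetaZeroOrder_lowOrdinate hj']
    have him : (1 / 2 + lowOrdinate j * I : ℂ).im = lowOrdinate j := by simp
    rw [him, Int.cast_one, one_mul]
    have ht := (lowOrdinate_spec hj').1.2
    have hp := (lowOrdinate_pos_lt hj').1
    refine (invSqTerm_le hj').trans (inv_anti₀ (by positivity) ?_)
    nlinarith
  have hsum := Finset.sum_le_sum hterm
  rw [← Finset.sum_div] at hsum
  have hnat : ∑ j ∈ Finset.range 29, (invSqTerm j : ℝ) = (invSqSum 29 : ℝ) := by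
    rw [invSqSum_eq]; push_cast; rfl
  rw [hnat] at hsum
  have hchk : (342005 : ℝ) * 2 ^ 60 ≤ (invSqSum 29 : ℝ) * (2 * 10 ^ 7) := by
    exact_mod_cast lowSums100_check.2.2.2
  have : (0.0342005 : ℝ) / 2 ≤ (invSqSum 29 : ℝ) / 2 ^ 60 := by
    rw [le_div_iff₀ (by positivity)]; linarith
  linarith

/-! ### `β` to eight digits and the tails above `2516` and `100` -/

/-- `log π > 1.14472988` (`π > 3.14159265358979323846`, kernel enclosures `logIv` of
`log 314159265358979323846` and `log 10`). [folklore] -/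
theorem log_pi_gt_d8 : (1.14472988 : ℝ) < Real.log π := by
  have h1 : Literature.Analysis.SpecialFunctions.KernelLog.logIv 314159265358979323846 =
      some (57056984931092685518380536, 57056984931093161127346492) := by decide +kernel
  have h2 : Literature.Analysis.SpecialFunctions.KernelLog.logIv 10 =
      some (2783654570780016011168420, 2783654570780491616991106) := by decide +kernel
  have hA := (Literature.Analysis.SpecialFunctions.KernelLog.logIv_sound h1).1
  have hB := (Literature.Analysis.SpecialFunctions.KernelLog.logIv_sound h2).2
  simp only [Nat.cast_ofNat] at hA hB
  have hπ := Real.pi_gt_d20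
  have hlog : Real.log (314159265358979323846 : ℝ) - 20 * Real.log 10 ≤ Real.log π := by
    have e : (314159265358979323846 : ℝ) = 3.14159265358979323846 * (10 : ℝ) ^ 20 := by norm_num
    rw [e, Real.log_mul (by norm_num) (by norm_num), Real.log_pow]
    push_cast
    have := Real.log_le_log (by norm_num) hπ.le
    linarith
  norm_num at hA hB ⊢
  linarith

/-- **`β < 0.04619147`** (`β = 2 + γ − log π − 2 log 2 = 0.0461914179…`). [cite: Nicolas2012, (1.3)] -/
theorem nicolasBeta_lt_d8 : nicolasBeta < 0.04619147 := by
  unfold nicolasBeta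
  have := Literature.Analysis.SpecialFunctions.Real.eulerMascheroniConstant_lt_d8
  have := log_pi_gt_d8
  have := Real.log_two_gt_d9
  linarith

/-- **The tail above `2516`**: under RH, `∑_{|Im ρ| > 2516} m(ρ)/|ρ|² = β − sumInvNormSq 2516 ≤ 0.00088473`.
[cite: Schoenfeld1976, proof of Thm. 10] -/
theorem tail_heightT0_le : nicolasBeta - sumInvNormSq heightT0 ≤ 0.00088473 := by
  linarith [nicolasBeta_lt_d8, le_sumInvNormSq_heightT0]

/-- **The tail above `100`**: `β − sumInvNormSq 100 ≤ 0.011991`. [cite: Schoenfeld1976, proof of Thm. 10] -/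
theorem tail_100_le : nicolasBeta - sumInvNormSq 100 ≤ 0.011991 := by
  linarith [nicolasBeta_lt_d8, le_sumInvNormSq_100]

end SchoenfeldBound

end Literature.NumberTheory.LFunctions

end
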